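import Summits.QuantumFields.YangMills.Theorems.UnitScaleTiltProp7SectET3HDeltaHOfRowsClosedT3
import Summits.QuantumFields.YangMills.Theorems.UnitScaleTiltProp7HessRowOfEq111T3
import Summits.QuantumFields.YangMills.Theorems.UnitScaleTiltProp7LandauDictT3
import HarnessLib

/-!
# Route `UnitScaleTilt`, crux «MinimiserStabilityRegPr» (stmt-QuantumFields-19200, stub EX), node N06(d = 3), route (α) — LAYER 0, ROWS (def-free):
# **«OP-ROWS» — THE GENERIC (BACKGROUND-ONLY) FORMS OF THE DISPLAYED (3.49)- AND (139)-ROWS.**  The four FIELD-SPECIFIC N06 rows of the EX display behind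
# `h46₂` ∪ `hΔsol` — `h349` and `h139` of ✓`Prop7SectET3HDeltaHOfRowsClosed.hΔH_of_rows'` (for the letter `H46 Y`), `hDPD` and `h139` of
# ✓`Prop7HessRowOfEq111.secondOrder_of_eq111_rows` (for the solution `Yf` of (111)) — are TWO OPERATOR ROWS about the background alone, read at two fields of the
# Landau class `R_S(U₀)(D*_{U₀}X) = 0` (a class both fields belong to BY LANDED THEOREMS: ✓`landauS_H46`, ✓`RS_DstarL2_sol`):
# `hOp349` = [Balaban1985Variational] p. 299 l. 13 «the fact that `DPD*` is a bounded operator» ([Balaban1985BackgroundPropagators] (3.49), `P = 1 − R`), and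
# `hOp139` = p. 299 l. 6 «`G′RD*` is a bounded operator in the norm |·|₍₁₎. The properties of `HB` and `J` imply the bound |Δ′_πHB|₍₋₃₎ ≦ O(1)|B|» ((138)–(139); by
# lit ✓`B11Eq138Polarization.eq138` the ONLY property of the field used is `(G′RD*)F = 0`, i.e. the Landau row, and its sup)

Cell `ym3-torus` (HUMAN RULING D-0037, YM ladder rung R3 — YM₃ on T³, NOT d = 4, NOT Clay; YM gap NOT proved), width seat `ym3-torus-px5` (gen 2; FILL-TO-CAP «width 5»); answers the
EX-knit namer ★ym-ust-19200-w2 g6 2026-08-28 19:26:38Z «if you hold generic-`x`∕generic-`Y` forms of `hC`∕`h139`∕`hDPD` say so and I cut to yours»; LOCATE memo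
`HOME/ym3-torus-px5/LOCATE-OPROWS-349-139-px5g2.md` = stmt-QuantumFields-19200 evidence #54.  THEOREMS ONLY (0 `def`, 0 `sorry`); `--supports stmt-QuantumFields-19200 --as helper`;
count-neutral; NO claim on crux ∕ stub ∕ registry; nothing of [Balaban1985BackgroundPropagators] §3 is asserted — the two rows ARE print's inputs, displayed by name.

THE TWO ROWS (member `F`, `h : n ≤ K`, weights `c₀ cB a`, background `U₀`, `η = eta F n K`; `X : PBond (F.P K) 0 → M₂(ℂ)` GENERIC, `s` a sup bound `‖X(bd)‖ ≤ s`):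
* **`hOp349`** (UNCONDITIONAL): `‖toL2⁻¹(D_{U₀}((1 − R_S(U₀))(D*_{U₀}(toL2 X))))(bd)‖ ≤ k₃₄₉·s` — «`DPD*` is a bounded operator», sup → sup, `η`-FREE although BOTH `DL2` and `DstarL2`
  carry `η⁻¹` ((3.3)∕(3.8)): `1 − R_S` smooths ((3.25) `1 − R = G′Q̃′†(Q̃′G′²Q̃′†)⁻¹Q̃′G′`; `DG′`, `G′D*` have `|x − x′|⁻²` kernels, integrable at scale `η` in d = 3).
  INHABITABILITY (★★OWNER RULING g27-№9 (3)): letters `DL2 DstarL2 RS toL2` of bricks L0a∕L0c only; `X = 0` trivial; at fixed `(F, K)` a finite-dimensional operator bound (true for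
  large `k₃₄₉`); the content — `k₃₄₉` uniform in `K` — is [B9] (3.49) p. 399 + (3.25) on the regular class (Thm 3.11), lit species ✓`B9Eq349DPBlockDecayLetters.DP_eq_comp3`
  (`T(U) = D_U(1 − R(U))` on the NE9 carriers): N06 storey ∕ desk I-06.
* **`hOp139`** (ON THE LANDAU CLASS): `R_S(D*(toL2 X)) = 0 → ‖toL2⁻¹((D G′ R_S D*)†(Δ^η(toL2 X)))(bd)‖ ≤ k₁₃₉·s` — «|Δ′_πF|₍₋₃₎ ≦ O(1)·sup|F| for `RD*F = 0`»; that
  `(DG′R_SD*)†Δ^η` IS the transposed gauge correction `Δ′_π` on such fields is ✓`Prop7SectET3H137Rows.DeltaEta_HT` ∕ ✓`Prop7HessRowOfEq111.DeltaEta_sol_eq`.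
  INHABITABILITY: letters `DL2 GprimeT RS DstarL2 DeltaEta toL2` only; `X = 0` trivial; finite-dimensional at fixed `(F, K)`; the content is (138) + «`G′RD*` bounded in
  |·|₍₁₎» ([B9] `B9Eq349ConjugatedGreenLetters` species) + the (28) size of `J` (✓`B11Eq98CurrentSlot.norm_Jcur_le`): N06 storey ∕ desk I-06.
CURRENCY CHECK.  `D¹(D¹*X) = η²·toL2⁻¹(DL2(DstarL2(toL2 X)))` (§1) ⇒ `hOp349` gives ✓p660172's `hDPD : ≤ k₄·nY·η²` VERBATIM (`k₄ := k₃₄₉`, `s := nY`) and, with (46)₀ (`s := BH·η·‖Y‖`),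
✓p656472's `h349 : ≤ c₃₄₉·η³·‖Y‖` (`c₃₄₉ := k₃₄₉·BH`); `hOp139` gives `h139 : ≤ c₁₃₉·η·‖Y‖` (`c₁₃₉ := k₁₃₉·BH`) and the solution's `s₁₃₉ := k₁₃₉·nY ≤ (k₁₃₉B₁∕2)·ρ`.

WHAT IS PROVED (ns `…Theorems.Prop7SectET3LandauOpRows`):
* §1 ★ `covDerivFwdT_covDivFormT_eq_smul_toL2` — THE DICTIONARY `covDerivFwdT 1 (bgUnits U₀) μ (covDivFormT 1 (bgUnits U₀) X) y = η² • toL2⁻¹(DL2 U₀ (DstarL2 U₀ (toL2 X))) ⟨y, μ⟩`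
  (✓`Prop7LandauDict.DL2_toL2S_eq_covDerivFwdT` ∕ `DstarL2_toL2_eq_covDivFormT` + the `η`-bookkeeping `D^η = η⁻¹D¹`), with `covDivFormT_eq_smul`, `covDerivFwdT_one_smul`.
* §2 ★★★ `hDPD_of_op349` — `hOp349` + `R_S(D*(toL2 X)) = 0` + `‖X(bd)‖ ≤ s` ⇒ `‖D¹_μ(D¹*X)(y)‖ ≤ k₃₄₉·s·η²` (✓p660172's `hDPD` shape, generic `X`); `k_nonneg_of_op349`, `k_nonneg_of_op139`.
* §3 AT THE LETTERS OF RECORD (`PosOnto …(Δ_π) U₀ ∧ PosPrime … U₀`): ★★★ `h349_H46_of_op349`, ★★★ `h139_H46_of_op139` (✓p656472's `h349`∕`h139` texts, via ✓`landauS_H46` + (46)₀);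
  ★★ `hDPD_sol_of_op349`, ★★ `h139_sol_of_op139` (✓p660172's `hDPD`∕`h139` texts for `toL2 Yf = −𝔊x + Hb`, via ✓`RS_DstarL2_sol`).
* §4 ★★★ `hΔH_of_opRows` — ✓`hΔH_of_rows'` ⟸ {`h46`, `h137`, `hOp139`, `hOp349`}: `BH″ = c₁₃₇ + (k₁₃₉ + k₃₄₉ + 32·ε₀)·BH`.
* §5 ★★★ `secondOrder_of_eq111_opRows` ∕ `_rho` — ✓`secondOrder_of_eq111_rows(_rho)` ⟸ the FOUR background-level rows {`hOpC` (generic `x`, the EX namer's (G17′) text), `h137` (generic `Y`,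
  ✓`hΔH_of_rows'` VERBATIM), `hOp139`, `hOp349`} + three sizes (`hYsup`∕`hnY`, `hx`∕`hsx`, `hb`∕`hsb`); `MΔ = cx + cC·cx + c₁₃₇·cb + k₁₃₉B₁∕2 + 14B₁ + k₃₄₉B₁∕2 + 2B₁`; readers `hC_of_opC`, `h137_of_genericY`; `k_nonneg_of_opC`, `k_nonneg_of_op137`.
EFFECT (EX display census): behind `h46₂` ∪ `hΔsol` the N06 instances {`h137 h139 h349`} ∪ {`hC h137′ h139sol hDPD`} (7 instances, 5 shapes) become {`h137` (generic-`Y`, shared),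
`hOpC` (generic-`x`), `hOp139`, `hOp349`} — 4 background-level operator rows, each one printed sentence, none mentioning `H`, `Y`, `B̃` or the solution (EX namer ★w2-19200 g6 (G18):
«adopted as THE EX residue-row shapes of record for both descents»).
HONEST SCOPE.  One dictionary identity, scalar exchanges, compositions BY NAME; the rows are NOT proved here (N06(d = 3)); not a proof of any stub; nothing continuum ∕ OS ∕ mass-gap ∕ Clay.
References: T. Bałaban, CMP **102** (1985) 277–309 [Balaban1985Variational] ((137)–(140) pp.298–299, (19) p.281, (45)–(46) p.285, (111) p.294, (133)–(136) p.298); CMP **99** (1985)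
389–434 [Balaban1985BackgroundPropagators] ((3.3) p.391, (3.8) p.392, (3.21)–(3.25) p.394, (3.49) p.399, (3.119)–(3.126) pp.419–420).
-/

set_option autoImplicit false

noncomputable section

open scoped InnerProductSpace ComplexConjugate Matrix.Norms.L2Operator

namespace Summit.QuantumFields.YangMills.Theorems.Prop7SectET3LandauOpRows

open Literature.MathematicalPhysics.QuantumFieldTheory.Balaban1983to89
open Literature.MathematicalPhysics.QuantumFieldTheory.Balaban1983to89.T3ContinuumYM3Torus
open Literature.MathematicalPhysics.QuantumFieldTheory.Balaban1983to89.T3PrintedRegularMinimiser (RegPr)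
open T3SectALandauChart (eta eta_pos covDerivFwdT formComp covCodiffCurlT covLapFormT covDivFormT bgUnits covDerivFwdT_eq_smul)
open B10Eq68TorusRegularity (covDerivT)
open B7Eq78Linearization (conjR conjR_smul_real)
open B9SectCLatticeCarrier (Bond)
open B9Eq311L2Pairing (WL2)
open B11Eq103H1Complex (SiteL2K BondL2K)
open Summit.QuantumFields.YangMills.Theorems.Prop7SectET3Transport (periodsT3)
open Summit.QuantumFields.YangMills.Theorems.Prop7SectET3HilbertLetters (W₂ toL2 toL2S toL2B DL2 DstarL2)
open Summit.QuantumFields.YangMills.Theorems.Prop7SectET3GaugeProjector (NS RS)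
open Summit.QuantumFields.YangMills.Theorems.Prop7SectET3WilsonHessian (DeltaEta)
open Summit.QuantumFields.YangMills.Theorems.Prop7SectET3CurvedPropagators
open Summit.QuantumFields.YangMills.Theorems.Prop7SectET3DeltaPi
open Summit.QuantumFields.YangMills.Theorems.Prop7LandauDict (DL2_toL2S_eq_covDerivFwdT DstarL2_toL2_eq_covDivFormT)
open Summit.QuantumFields.YangMills.Theorems.Prop7HessRowOfEq111 (RS_DstarL2_sol secondOrder_of_eq111_rows secondOrder_of_eq111_rows_rho)
open Summit.QuantumFields.YangMills.Theorems.Prop7SectET3HDeltaHOfRowsClosed (hΔH_of_rows')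

variable {F : T3Family} {n K : ℕ} {h : n ≤ K} {c₀ cB a : ℝ} [Fact (0 < c₀)] [Fact (0 < cB)]

/-! ## §1 The dictionary: `D¹_{U₀}(D¹*_{U₀}X)` on the route carriers is `η²·toL2⁻¹(D_{U₀}D*_{U₀}(toL2 X))` -/

/-- `D^{η*}_U X = η⁻¹·D^{1*}_U X` for the covariant divergence of a one-form (the prefactor of [6] (1.1) is the only place the spacing enters).
[cite: Balaban1985RegularSpaces, (1.1)–(1.2) p.76] -/
theorem covDivFormT_eq_smul (η : ℝ) (V : GaugeField (F.P K) 0 (Matrix (Fin 2) (Fin 2) ℂ)ˣ) (X : PBond (F.P K) 0 → Matrix (Fin 2) (Fin 2) ℂ) (x : Site (F.P K) 0) :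
    covDivFormT η V X x = η⁻¹ • covDivFormT 1 V X x := by
  simp only [covDivFormT, covDerivT, inv_one, one_smul, Finset.smul_sum]

/-- `D¹_{U,μ}` is real-linear in the differentiated function: `D¹_{U,μ}(c·G) = c·D¹_{U,μ}G` (`R(U)` is linear, ✓`conjR_smul_real`). [cite: Balaban1985RegularSpaces, (1.1) p.76] -/
theorem covDerivFwdT_one_smul (V : GaugeField (F.P K) 0 (Matrix (Fin 2) (Fin 2) ℂ)ˣ) (μ : Fin (F.P K).d) (c : ℝ) (G : Site (F.P K) 0 → Matrix (Fin 2) (Fin 2) ℂ)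
    (x : Site (F.P K) 0) :
    covDerivFwdT 1 V μ (c • G) x = c • covDerivFwdT 1 V μ G x := by
  simp only [covDerivFwdT, Pi.smul_apply, conjR_smul_real, smul_sub, inv_one, one_smul]

/-- ★ **THE DICTIONARY** — the (140)∕(3.49) member `D¹_{U₀,μ}(D¹*_{U₀}X)(y)` of the route's unit-spacing calculus (`T3SectALandauChart` §2) IS `η²` times brick L0a's
`D_{U₀}(D*_{U₀}(toL2 X))` read back at the bond `⟨y, μ⟩` ((3.3)∕(3.8) at spacing `η`: ✓`Prop7LandauDict`; `D^η = η⁻¹D¹` twice).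
[cite: Balaban1985BackgroundPropagators, (3.3) p.391, (3.8) p.392; Balaban1985Variational, (140) p.299] -/
theorem covDerivFwdT_covDivFormT_eq_smul_toL2 (U₀ : GaugeField (F.P K) 0 (Matrix.specialUnitaryGroup (Fin 2) ℂ)) (X : PBond (F.P K) 0 → Matrix (Fin 2) (Fin 2) ℂ)
    (μ : Fin (F.P K).d) (y : Site (F.P K) 0) :
    covDerivFwdT 1 (bgUnits F K U₀) μ (covDivFormT 1 (bgUnits F K U₀) X) y
      = (eta F n K ^ 2) • (toL2 F K c₀).symm (DL2 F n K c₀ U₀ (DstarL2 F n K c₀ U₀ (toL2 F K c₀ X))) ⟨y, μ⟩ := by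
  have hη : eta F n K ≠ 0 := (eta_pos F n K).ne'
  -- `D*(toL2 X) = toL2S (D^{η*}X)`
  have hD : DstarL2 F n K c₀ U₀ (toL2 F K c₀ X) = toL2S F K c₀ (covDivFormT (eta F n K) (bgUnits F K U₀) X) := by
    rw [← LinearEquiv.symm_apply_eq]
    funext x
    exact DstarL2_toL2_eq_covDivFormT F n K c₀ U₀ X x
  -- `D^{η*}X = η⁻¹·D^{1*}X` as site functions
  have hfun : covDivFormT (eta F n K) (bgUnits F K U₀) X = (eta F n K)⁻¹ • covDivFormT 1 (bgUnits F K U₀) X := by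
    funext x
    rw [Pi.smul_apply]
    exact covDivFormT_eq_smul (eta F n K) (bgUnits F K U₀) X x
  rw [hD, DL2_toL2S_eq_covDerivFwdT, hfun]
  change covDerivFwdT 1 (bgUnits F K U₀) μ (covDivFormT 1 (bgUnits F K U₀) X) y
      = eta F n K ^ 2 • covDerivFwdT (eta F n K) (bgUnits F K U₀) μ ((eta F n K)⁻¹ • covDivFormT 1 (bgUnits F K U₀) X) y
  rw [covDerivFwdT_eq_smul (eta F n K), covDerivFwdT_one_smul, smul_smul, smul_smul]
  have hc : eta F n K ^ 2 * (eta F n K)⁻¹ * (eta F n K)⁻¹ = 1 := by field_simp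
  rw [hc, one_smul]

/-! ## §2 The (3.49) operator row read at ANY field of the Landau class -/

omit [Fact (0 < cB)] in
/-- ★★★ **«`DPD*` IS A BOUNDED OPERATOR» ⇒ THE (3.49) ROW FOR EVERY LANDAU FIELD** — from the displayed operator row `hOp349`
(`‖toL2⁻¹(D(1 − R_S)D*(toL2 X))‖ ≤ k₃₄₉·sup‖X‖`, generic `X`), a field with `R_S(D*_{U₀}(toL2 X)) = 0` ((21)∕(45)₂) and `‖X(bd)‖ ≤ s` has `‖D¹_{U₀,μ}(D¹*_{U₀}X)(y)‖ ≤ k₃₄₉·s·η²` — EXACTLY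
the shape of ✓`Prop7HessRowOfEq111.secondOrder_of_eq111_rows`'s `hDPD` (`k₄ := k₃₄₉`, `nY := s`). [cite: Balaban1985Variational, (140) p.299 l.13, (21) p.281; Balaban1985BackgroundPropagators, (3.49) p.399] -/
theorem hDPD_of_op349 (U₀ : GaugeField (F.P K) 0 (Matrix.specialUnitaryGroup (Fin 2) ℂ)) {k349 : ℝ}
    (hOp349 : ∀ (X : PBond (F.P K) 0 → Matrix (Fin 2) (Fin 2) ℂ) (s : ℝ), (∀ bd, ‖X bd‖ ≤ s) → ∀ bd : PBond (F.P K) 0,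
      ‖(toL2 F K c₀).symm (DL2 F n K c₀ U₀ (DstarL2 F n K c₀ U₀ (toL2 F K c₀ X) - RS F n K h c₀ cB U₀ (DstarL2 F n K c₀ U₀ (toL2 F K c₀ X)))) bd‖ ≤ k349 * s)
    (X : PBond (F.P K) 0 → Matrix (Fin 2) (Fin 2) ℂ) {s : ℝ} (hL : RS F n K h c₀ cB U₀ (DstarL2 F n K c₀ U₀ (toL2 F K c₀ X)) = 0) (hX : ∀ bd, ‖X bd‖ ≤ s)
    (μ : Fin (F.P K).d) (y : Site (F.P K) 0) :
    ‖covDerivFwdT 1 (bgUnits F K U₀) μ (covDivFormT 1 (bgUnits F K U₀) X) y‖ ≤ k349 * s * eta F n K ^ 2 := by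
  have h1 := hOp349 X s hX ⟨y, μ⟩
  rw [hL, sub_zero] at h1
  rw [covDerivFwdT_covDivFormT_eq_smul_toL2 (n := n) (c₀ := c₀), norm_smul, Real.norm_of_nonneg (sq_nonneg _)]
  calc eta F n K ^ 2 * ‖(toL2 F K c₀).symm (DL2 F n K c₀ U₀ (DstarL2 F n K c₀ U₀ (toL2 F K c₀ X))) ⟨y, μ⟩‖
      ≤ eta F n K ^ 2 * (k349 * s) := mul_le_mul_of_nonneg_left h1 (sq_nonneg _)
    _ = k349 * s * eta F n K ^ 2 := by ring

omit [Fact (0 < cB)] in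
/-- The constant of the (3.49) operator row is non-negative (read the row at `X = 0`, `s = 1`). [cite: Balaban1985BackgroundPropagators, (3.49) p.399] -/
theorem k_nonneg_of_op349 (U₀ : GaugeField (F.P K) 0 (Matrix.specialUnitaryGroup (Fin 2) ℂ)) {k349 : ℝ}
    (hOp349 : ∀ (X : PBond (F.P K) 0 → Matrix (Fin 2) (Fin 2) ℂ) (s : ℝ), (∀ bd, ‖X bd‖ ≤ s) → ∀ bd : PBond (F.P K) 0,
      ‖(toL2 F K c₀).symm (DL2 F n K c₀ U₀ (DstarL2 F n K c₀ U₀ (toL2 F K c₀ X) - RS F n K h c₀ cB U₀ (DstarL2 F n K c₀ U₀ (toL2 F K c₀ X)))) bd‖ ≤ k349 * s) :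
    0 ≤ k349 := by
  have h1 := hOp349 0 1 (fun bd => by rw [Pi.zero_apply, norm_zero]; exact zero_le_one) ⟨default, ⟨0, (F.P K).hd⟩⟩
  rw [mul_one] at h1
  exact (norm_nonneg _).trans h1

/-- The constant of the (139) operator row is non-negative (the zero field is in the Landau class; read the row at `X = 0`, `s = 1`). [cite: Balaban1985Variational, (139) p.299] -/
theorem k_nonneg_of_op139 (U₀ : GaugeField (F.P K) 0 (Matrix.specialUnitaryGroup (Fin 2) ℂ)) {k139 : ℝ}
    (hOp139 : ∀ (X : PBond (F.P K) 0 → Matrix (Fin 2) (Fin 2) ℂ) (s : ℝ), RS F n K h c₀ cB U₀ (DstarL2 F n K c₀ U₀ (toL2 F K c₀ X)) = 0 → (∀ bd, ‖X bd‖ ≤ s) →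
      ∀ bd : PBond (F.P K) 0, ‖(toL2 F K c₀).symm (LinearMap.adjoint
          (DL2 F n K c₀ U₀ ∘ₗ GprimeT F n K h c₀ cB a U₀ ∘ₗ RS F n K h c₀ cB U₀ ∘ₗ DstarL2 F n K c₀ U₀)
          (DeltaEta F n K c₀ U₀ (toL2 F K c₀ X))) bd‖ ≤ k139 * s) :
    0 ≤ k139 := by
  have h1 := hOp139 0 1 (by rw [map_zero, map_zero, map_zero]) (fun bd => by rw [Pi.zero_apply, norm_zero]; exact zero_le_one) ⟨default, ⟨0, (F.P K).hd⟩⟩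
  rw [mul_one] at h1
  exact (norm_nonneg _).trans h1

/-! ## §3 The two rows read at the letters of record: `H46 Y` ((45)₂ ✓`landauS_H46`) and the solution of (111) (✓`RS_DstarL2_sol`) -/

/-- ★★★ **✓p656472's `h349` FROM THE OPERATOR ROW** — the (140)-step for the route letter: `‖D¹_{U₀}(D¹*_{U₀}(H46 Y))‖ ≤ (k₃₄₉·BH)·η³·‖Y‖` from `hOp349`, (45)₂ `R_SD*(H46 Y) = 0`
(✓`landauS_H46`) and (46)₀ `‖H46 Y‖ ≤ BH·η·‖Y‖`; i.e. `c₃₄₉ := k₃₄₉·BH`. [cite: Balaban1985Variational, (140) p.299, (45)–(46) p.285; Balaban1985BackgroundPropagators, (3.49) p.399] -/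
theorem h349_H46_of_op349 {U₀ : GaugeField (F.P K) 0 (Matrix.specialUnitaryGroup (Fin 2) ℂ)}
    (hp : PosOnto F n K h c₀ cB a (DeltaPiSlot F n K h c₀ cB a) U₀) (hq : PosPrime F n K h c₀ cB a U₀) {BH k349 : ℝ}
    (h46 : ∀ (Y : PBond (F.P n) 0 → Matrix (Fin 2) (Fin 2) ℂ) (b : PBond (F.P K) 0), ‖H46 F n K h c₀ cB a U₀ Y b‖ ≤ BH * eta F n K * ‖Y‖)
    (hOp349 : ∀ (X : PBond (F.P K) 0 → Matrix (Fin 2) (Fin 2) ℂ) (s : ℝ), (∀ bd, ‖X bd‖ ≤ s) → ∀ bd : PBond (F.P K) 0,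
      ‖(toL2 F K c₀).symm (DL2 F n K c₀ U₀ (DstarL2 F n K c₀ U₀ (toL2 F K c₀ X) - RS F n K h c₀ cB U₀ (DstarL2 F n K c₀ U₀ (toL2 F K c₀ X)))) bd‖ ≤ k349 * s)
    (Y : PBond (F.P n) 0 → Matrix (Fin 2) (Fin 2) ℂ) (μ : Fin (F.P K).d) (x : Site (F.P K) 0) :
    ‖covDerivFwdT 1 (bgUnits F K U₀) μ (covDivFormT 1 (bgUnits F K U₀) (H46 F n K h c₀ cB a U₀ Y)) x‖ ≤ k349 * BH * eta F n K ^ 3 * ‖Y‖ := by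
  have h1 := hDPD_of_op349 (h := h) (cB := cB) U₀ hOp349 (H46 F n K h c₀ cB a U₀ Y) (landauS_H46 hp hq Y) (fun b => h46 Y b) μ x
  calc ‖covDerivFwdT 1 (bgUnits F K U₀) μ (covDivFormT 1 (bgUnits F K U₀) (H46 F n K h c₀ cB a U₀ Y)) x‖
      ≤ k349 * (BH * eta F n K * ‖Y‖) * eta F n K ^ 2 := h1
    _ = k349 * BH * eta F n K ^ 3 * ‖Y‖ := by ring

/-- ★★★ **✓p656472's `h139` FROM THE OPERATOR ROW** — print's (139) for the route letter: `‖toL2⁻¹((DG′R_SD*)†(Δ^η(toL2 (H46 Y))))‖ ≤ (k₁₃₉·BH)·η·‖Y‖` from `hOp139` on the Landau class,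
(45)₂ and (46)₀; i.e. `c₁₃₉ := k₁₃₉·BH`. [cite: Balaban1985Variational, (138)–(139) p.299, (45)–(46) p.285] -/
theorem h139_H46_of_op139 {U₀ : GaugeField (F.P K) 0 (Matrix.specialUnitaryGroup (Fin 2) ℂ)}
    (hp : PosOnto F n K h c₀ cB a (DeltaPiSlot F n K h c₀ cB a) U₀) (hq : PosPrime F n K h c₀ cB a U₀) {BH k139 : ℝ}
    (h46 : ∀ (Y : PBond (F.P n) 0 → Matrix (Fin 2) (Fin 2) ℂ) (b : PBond (F.P K) 0), ‖H46 F n K h c₀ cB a U₀ Y b‖ ≤ BH * eta F n K * ‖Y‖)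
    (hOp139 : ∀ (X : PBond (F.P K) 0 → Matrix (Fin 2) (Fin 2) ℂ) (s : ℝ), RS F n K h c₀ cB U₀ (DstarL2 F n K c₀ U₀ (toL2 F K c₀ X)) = 0 → (∀ bd, ‖X bd‖ ≤ s) →
      ∀ bd : PBond (F.P K) 0, ‖(toL2 F K c₀).symm (LinearMap.adjoint
          (DL2 F n K c₀ U₀ ∘ₗ GprimeT F n K h c₀ cB a U₀ ∘ₗ RS F n K h c₀ cB U₀ ∘ₗ DstarL2 F n K c₀ U₀)
          (DeltaEta F n K c₀ U₀ (toL2 F K c₀ X))) bd‖ ≤ k139 * s)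
    (Y : PBond (F.P n) 0 → Matrix (Fin 2) (Fin 2) ℂ) (b : PBond (F.P K) 0) :
    ‖(toL2 F K c₀).symm (LinearMap.adjoint
        (DL2 F n K c₀ U₀ ∘ₗ GprimeT F n K h c₀ cB a U₀ ∘ₗ RS F n K h c₀ cB U₀ ∘ₗ DstarL2 F n K c₀ U₀)
        (DeltaEta F n K c₀ U₀ (toL2 F K c₀ (H46 F n K h c₀ cB a U₀ Y)))) b‖ ≤ k139 * BH * eta F n K * ‖Y‖ := by
  have h1 := hOp139 (H46 F n K h c₀ cB a U₀ Y) (BH * eta F n K * ‖Y‖) (landauS_H46 hp hq Y) (fun b => h46 Y b) b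
  calc _ ≤ k139 * (BH * eta F n K * ‖Y‖) := h1
    _ = k139 * BH * eta F n K * ‖Y‖ := by ring

/-- ★★ **✓p660172's `hDPD` FOR THE SOLUTION OF (111) FROM THE OPERATOR ROW** — for `Yf` with `toL2 Yf = −𝔊x + Hb` at the slot of record (Landau by (102)L+(129)L, ✓`RS_DstarL2_sol`) and
`‖Yf(bd)‖ ≤ nY`: `‖D¹(D¹*Yf)‖ ≤ k₃₄₉·nY·η²`. [cite: Balaban1985Variational, (102) p.293, (129) p.297, (140) p.299; Balaban1985BackgroundPropagators, (3.49) p.399, (3.124) p.420] -/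
theorem hDPD_sol_of_op349 {U₀ : GaugeField (F.P K) 0 (Matrix.specialUnitaryGroup (Fin 2) ℂ)}
    (hp : PosOnto F n K h c₀ cB a (DeltaPiSlot F n K h c₀ cB a) U₀) (hq : PosPrime F n K h c₀ cB a U₀) {k349 : ℝ}
    (hOp349 : ∀ (X : PBond (F.P K) 0 → Matrix (Fin 2) (Fin 2) ℂ) (s : ℝ), (∀ bd, ‖X bd‖ ≤ s) → ∀ bd : PBond (F.P K) 0,
      ‖(toL2 F K c₀).symm (DL2 F n K c₀ U₀ (DstarL2 F n K c₀ U₀ (toL2 F K c₀ X) - RS F n K h c₀ cB U₀ (DstarL2 F n K c₀ U₀ (toL2 F K c₀ X)))) bd‖ ≤ k349 * s)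
    (x : BondL2K ℂ 3 (periodsT3 F K) c₀ W₂) (b : WL2 ℂ (fun _ : PBond (F.P n) 0 => cB) W₂) (Yf : PBond (F.P K) 0 → Matrix (Fin 2) (Fin 2) ℂ)
    (hY : toL2 F K c₀ Yf = -(frakGT F n K h c₀ cB a (DeltaPiSlot F n K h c₀ cB a) U₀ x) + HT F n K h c₀ cB a (DeltaPiSlot F n K h c₀ cB a) U₀ b)
    {nY : ℝ} (hYsup : ∀ bd, ‖Yf bd‖ ≤ nY) (μ : Fin (F.P K).d) (y : Site (F.P K) 0) :
    ‖covDerivFwdT 1 (bgUnits F K U₀) μ (covDivFormT 1 (bgUnits F K U₀) Yf) y‖ ≤ k349 * nY * eta F n K ^ 2 := by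
  refine hDPD_of_op349 (h := h) (cB := cB) U₀ hOp349 Yf ?_ hYsup μ y
  rw [hY]
  exact RS_DstarL2_sol hp (DeltaPiSlot_kills_NS hq) (inner_DL2_DeltaPi_eq_zero hq) x b

/-- ★★ **✓p660172's `h139` FOR THE SOLUTION OF (111) FROM THE OPERATOR ROW** — for `Yf` with `toL2 Yf = −𝔊x + Hb` at the slot of record and `‖Yf(bd)‖ ≤ nY`:
`‖toL2⁻¹((DG′R_SD*)†(Δ^η(toL2 Yf)))‖ ≤ k₁₃₉·nY` (so `s₁₃₉ := k₁₃₉·nY`). [cite: Balaban1985Variational, (138)–(139) p.299, (102) p.293, (129) p.297] -/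
theorem h139_sol_of_op139 {U₀ : GaugeField (F.P K) 0 (Matrix.specialUnitaryGroup (Fin 2) ℂ)}
    (hp : PosOnto F n K h c₀ cB a (DeltaPiSlot F n K h c₀ cB a) U₀) (hq : PosPrime F n K h c₀ cB a U₀) {k139 : ℝ}
    (hOp139 : ∀ (X : PBond (F.P K) 0 → Matrix (Fin 2) (Fin 2) ℂ) (s : ℝ), RS F n K h c₀ cB U₀ (DstarL2 F n K c₀ U₀ (toL2 F K c₀ X)) = 0 → (∀ bd, ‖X bd‖ ≤ s) →
      ∀ bd : PBond (F.P K) 0, ‖(toL2 F K c₀).symm (LinearMap.adjoint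
          (DL2 F n K c₀ U₀ ∘ₗ GprimeT F n K h c₀ cB a U₀ ∘ₗ RS F n K h c₀ cB U₀ ∘ₗ DstarL2 F n K c₀ U₀)
          (DeltaEta F n K c₀ U₀ (toL2 F K c₀ X))) bd‖ ≤ k139 * s)
    (x : BondL2K ℂ 3 (periodsT3 F K) c₀ W₂) (b : WL2 ℂ (fun _ : PBond (F.P n) 0 => cB) W₂) (Yf : PBond (F.P K) 0 → Matrix (Fin 2) (Fin 2) ℂ)
    (hY : toL2 F K c₀ Yf = -(frakGT F n K h c₀ cB a (DeltaPiSlot F n K h c₀ cB a) U₀ x) + HT F n K h c₀ cB a (DeltaPiSlot F n K h c₀ cB a) U₀ b)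
    {nY : ℝ} (hYsup : ∀ bd, ‖Yf bd‖ ≤ nY) (bd : PBond (F.P K) 0) :
    ‖(toL2 F K c₀).symm (LinearMap.adjoint
        (DL2 F n K c₀ U₀ ∘ₗ GprimeT F n K h c₀ cB a U₀ ∘ₗ RS F n K h c₀ cB U₀ ∘ₗ DstarL2 F n K c₀ U₀)
        (DeltaEta F n K c₀ U₀ (toL2 F K c₀ Yf))) bd‖ ≤ k139 * nY := by
  refine hOp139 Yf nY ?_ hYsup bd
  rw [hY]
  exact RS_DstarL2_sol hp (DeltaPiSlot_kills_NS hq) (inner_DL2_DeltaPi_eq_zero hq) x b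

/-! ## §4 `hΔH` for the letter of record from {`h46`, `h137`, `hOp139`, `hOp349`} -/

/-- ★★★ **THE (S)-SUB-ROW `hΔH` FROM `h46`, `h137` AND THE TWO OPERATOR ROWS** ([Balaban1985Variational] (137)–(140) «`D*DH`, `Δ_{U₀}H` bounded in `|·|₍₋₃₎`» for `H46` at the T³
member): ✓`hΔH_of_rows'` with `h139 := h139_H46_of_op139`, `h349 := h349_H46_of_op349`, hence `BH″ = c₁₃₇ + k₁₃₉·BH + k₃₄₉·BH + (28 + 4)·ε₀·BH`.
[cite: Balaban1985Variational, (137)–(140) pp.298–299, (19) p.281; Balaban1985BackgroundPropagators, (3.49) p.399, (3.126) p.420] -/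
theorem hΔH_of_opRows {U₀ : GaugeField (F.P K) 0 (Matrix.specialUnitaryGroup (Fin 2) ℂ)} {ε₀ : ℝ} (hreg : RegPr F n K ε₀ U₀)
    (hp : PosOnto F n K h c₀ cB a (DeltaPiSlot F n K h c₀ cB a) U₀) (hq : PosPrime F n K h c₀ cB a U₀) {BH c137 k139 k349 : ℝ}
    (hε₀ : 0 ≤ ε₀) (hBH : 0 ≤ BH)
    (h46 : ∀ (Y : PBond (F.P n) 0 → Matrix (Fin 2) (Fin 2) ℂ) (b : PBond (F.P K) 0), ‖H46 F n K h c₀ cB a U₀ Y b‖ ≤ BH * eta F n K * ‖Y‖)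
    (h137 : ∀ (Y : PBond (F.P n) 0 → Matrix (Fin 2) (Fin 2) ℂ) (b : PBond (F.P K) 0),
      ‖(toL2 F K c₀).symm (LinearMap.adjoint (Qk F n K h c₀ cB U₀) (KinvT F n K h c₀ cB a (DeltaPiSlot F n K h c₀ cB a) U₀ (toL2B F n cB Y))
          - LinearMap.adjoint (Qk F n K h c₀ cB U₀) (((a : ℂ)) • toL2B F n cB Y)) b‖ ≤ c137 * ‖Y‖)
    (hOp139 : ∀ (X : PBond (F.P K) 0 → Matrix (Fin 2) (Fin 2) ℂ) (s : ℝ), RS F n K h c₀ cB U₀ (DstarL2 F n K c₀ U₀ (toL2 F K c₀ X)) = 0 → (∀ bd, ‖X bd‖ ≤ s) →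
      ∀ bd : PBond (F.P K) 0, ‖(toL2 F K c₀).symm (LinearMap.adjoint
          (DL2 F n K c₀ U₀ ∘ₗ GprimeT F n K h c₀ cB a U₀ ∘ₗ RS F n K h c₀ cB U₀ ∘ₗ DstarL2 F n K c₀ U₀)
          (DeltaEta F n K c₀ U₀ (toL2 F K c₀ X))) bd‖ ≤ k139 * s)
    (hOp349 : ∀ (X : PBond (F.P K) 0 → Matrix (Fin 2) (Fin 2) ℂ) (s : ℝ), (∀ bd, ‖X bd‖ ≤ s) → ∀ bd : PBond (F.P K) 0,
      ‖(toL2 F K c₀).symm (DL2 F n K c₀ U₀ (DstarL2 F n K c₀ U₀ (toL2 F K c₀ X) - RS F n K h c₀ cB U₀ (DstarL2 F n K c₀ U₀ (toL2 F K c₀ X)))) bd‖ ≤ k349 * s) :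
    (∀ (Y : PBond (F.P n) 0 → Matrix (Fin 2) (Fin 2) ℂ) (μ : Fin (F.P K).d) (x : Site (F.P K) 0),
        ‖covCodiffCurlT 1 (bgUnits F K U₀) (H46 F n K h c₀ cB a U₀ Y) μ x‖
          ≤ (c137 + k139 * BH + k349 * BH + (28 + 4) * ε₀ * BH) * eta F n K ^ 3 * ‖Y‖) ∧
    (∀ (Y : PBond (F.P n) 0 → Matrix (Fin 2) (Fin 2) ℂ) (ν : Fin (F.P K).d) (x : Site (F.P K) 0),
        ‖covLapFormT 1 (bgUnits F K U₀) (H46 F n K h c₀ cB a U₀ Y) ν x‖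
          ≤ (c137 + k139 * BH + k349 * BH + (28 + 4) * ε₀ * BH) * eta F n K ^ 3 * ‖Y‖) :=
  hΔH_of_rows' (h := h) hreg hp hq hε₀ hBH (mul_nonneg (k_nonneg_of_op349 (n := n) (h := h) (cB := cB) U₀ hOp349) hBH) h46 h137
    (h139_H46_of_op139 hp hq h46 hOp139) (h349_H46_of_op349 hp hq h46 hOp349)

/-! ## §5 `hΔsol`'s supplier ✓`secondOrder_of_eq111_rows(_rho)` with `hC`, `h137` GENERIC and `h139`, `hDPD` discharged by the operator rows -/

/-- The constant of the generic `(1 − P₀*) + multiplier` operator row `hOpC` (EX namer ★w2-19200 g6 (G17′)∕(G18) text) is non-negative (read the row at the constant field `1`, whose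
readback has positive sup norm). [cite: Balaban1985Variational, (133) p.298; Balaban1985BackgroundPropagators, (3.42) p.397, (3.49) p.399] -/
theorem k_nonneg_of_opC (U₀ : GaugeField (F.P K) 0 (Matrix.specialUnitaryGroup (Fin 2) ℂ)) {cC : ℝ}
    (hOpC : ∀ (x : BondL2K ℂ 3 (periodsT3 F K) c₀ W₂) (bd : PBond (F.P K) 0),
      ‖(toL2 F K c₀).symm (LinearMap.adjoint (Qk F n K h c₀ cB U₀) (KinvT F n K h c₀ cB a (DeltaPiSlot F n K h c₀ cB a) U₀
          (Qk F n K h c₀ cB U₀ (GT F n K h c₀ cB a (DeltaPiSlot F n K h c₀ cB a) U₀ x)))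
          + DL2 F n K c₀ U₀ (RS F n K h c₀ cB U₀ (DstarL2 F n K c₀ U₀ (GT F n K h c₀ cB a (DeltaPiSlot F n K h c₀ cB a) U₀ x)))) bd‖
        ≤ cC * ‖(toL2 F K c₀).symm x‖) :
    0 ≤ cC := by
  have hY : (fun _ : PBond (F.P K) 0 => (1 : Matrix (Fin 2) (Fin 2) ℂ)) ≠ 0 :=
    fun h0 => one_ne_zero (congrFun h0 ⟨default, ⟨0, (F.P K).hd⟩⟩)
  have hpos : 0 < ‖(fun _ : PBond (F.P K) 0 => (1 : Matrix (Fin 2) (Fin 2) ℂ))‖ := norm_pos_iff.mpr hY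
  have h1 := hOpC (toL2 F K c₀ (fun _ => 1)) ⟨default, ⟨0, (F.P K).hd⟩⟩
  rw [LinearEquiv.symm_apply_apply] at h1
  have h2 : 0 * ‖(fun _ : PBond (F.P K) 0 => (1 : Matrix (Fin 2) (Fin 2) ℂ))‖ ≤ cC * ‖(fun _ : PBond (F.P K) 0 => (1 : Matrix (Fin 2) (Fin 2) ℂ))‖ := by
    rw [zero_mul]; exact (norm_nonneg _).trans h1
  exact le_of_mul_le_mul_right h2 hpos

/-- The constant of the generic-`Y` (137) row `h137` (✓`hΔH_of_rows'` text) is non-negative (read the row at the constant block field `1`).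
[cite: Balaban1985Variational, (137) p.298; Balaban1985BackgroundPropagators, (3.126) p.420] -/
theorem k_nonneg_of_op137 (U₀ : GaugeField (F.P K) 0 (Matrix.specialUnitaryGroup (Fin 2) ℂ)) {c137 : ℝ}
    (h137 : ∀ (Y : PBond (F.P n) 0 → Matrix (Fin 2) (Fin 2) ℂ) (b : PBond (F.P K) 0),
      ‖(toL2 F K c₀).symm (LinearMap.adjoint (Qk F n K h c₀ cB U₀) (KinvT F n K h c₀ cB a (DeltaPiSlot F n K h c₀ cB a) U₀ (toL2B F n cB Y))
          - LinearMap.adjoint (Qk F n K h c₀ cB U₀) (((a : ℂ)) • toL2B F n cB Y)) b‖ ≤ c137 * ‖Y‖) :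
    0 ≤ c137 := by
  have hY : (fun _ : PBond (F.P n) 0 => (1 : Matrix (Fin 2) (Fin 2) ℂ)) ≠ 0 :=
    fun h0 => one_ne_zero (congrFun h0 ⟨default, ⟨0, (F.P n).hd⟩⟩)
  have hpos : 0 < ‖(fun _ : PBond (F.P n) 0 => (1 : Matrix (Fin 2) (Fin 2) ℂ))‖ := norm_pos_iff.mpr hY
  have h1 := h137 (fun _ => 1) ⟨default, ⟨0, (F.P K).hd⟩⟩
  have h2 : 0 * ‖(fun _ : PBond (F.P n) 0 => (1 : Matrix (Fin 2) (Fin 2) ℂ))‖ ≤ c137 * ‖(fun _ : PBond (F.P n) 0 => (1 : Matrix (Fin 2) (Fin 2) ℂ))‖ := by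
    rw [zero_mul]; exact (norm_nonneg _).trans h1
  exact le_of_mul_le_mul_right h2 hpos

/-- ★ **THE GENERIC `(1 − P₀*) + multiplier` ROW READ AT ONE `x`** with `‖toL2⁻¹x(bd)‖ ≤ sx`: `≤ cC·sx` (✓p660172's `hC` shape; Pi-norm `‖toL2⁻¹x‖ ≤ sx` and `0 ≤ cC` from the row).
[cite: Balaban1985Variational, (133) p.298; Balaban1985BackgroundPropagators, (3.42) p.397, (3.49) p.399] -/
theorem hC_of_opC (U₀ : GaugeField (F.P K) 0 (Matrix.specialUnitaryGroup (Fin 2) ℂ)) {cC sx : ℝ}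
    (hOpC : ∀ (x : BondL2K ℂ 3 (periodsT3 F K) c₀ W₂) (bd : PBond (F.P K) 0),
      ‖(toL2 F K c₀).symm (LinearMap.adjoint (Qk F n K h c₀ cB U₀) (KinvT F n K h c₀ cB a (DeltaPiSlot F n K h c₀ cB a) U₀
          (Qk F n K h c₀ cB U₀ (GT F n K h c₀ cB a (DeltaPiSlot F n K h c₀ cB a) U₀ x)))
          + DL2 F n K c₀ U₀ (RS F n K h c₀ cB U₀ (DstarL2 F n K c₀ U₀ (GT F n K h c₀ cB a (DeltaPiSlot F n K h c₀ cB a) U₀ x)))) bd‖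
        ≤ cC * ‖(toL2 F K c₀).symm x‖)
    (x : BondL2K ℂ 3 (periodsT3 F K) c₀ W₂) (hx : ∀ bd, ‖(toL2 F K c₀).symm x bd‖ ≤ sx) (bd : PBond (F.P K) 0) :
    ‖(toL2 F K c₀).symm (LinearMap.adjoint (Qk F n K h c₀ cB U₀) (KinvT F n K h c₀ cB a (DeltaPiSlot F n K h c₀ cB a) U₀
        (Qk F n K h c₀ cB U₀ (GT F n K h c₀ cB a (DeltaPiSlot F n K h c₀ cB a) U₀ x)))
        + DL2 F n K c₀ U₀ (RS F n K h c₀ cB U₀ (DstarL2 F n K c₀ U₀ (GT F n K h c₀ cB a (DeltaPiSlot F n K h c₀ cB a) U₀ x)))) bd‖ ≤ cC * sx := by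
  have hsx0 : 0 ≤ sx := (norm_nonneg _).trans (hx ⟨default, ⟨0, (F.P K).hd⟩⟩)
  exact (hOpC x bd).trans (mul_le_mul_of_nonneg_left ((pi_norm_le_iff_of_nonneg hsx0).mpr hx) (k_nonneg_of_opC (n := n) (h := h) (cB := cB) (a := a) U₀ hOpC))

/-- ★ **THE GENERIC-`Y` (137) ROW READ AT ONE COARSE DATUM `b`** with `‖toL2B⁻¹b(c)‖ ≤ sb`: `≤ c₁₃₇·sb` at `Y := toL2B⁻¹ b` (✓p660172's `h137` shape).
[cite: Balaban1985Variational, (137) p.298; Balaban1985BackgroundPropagators, (3.126) p.420] -/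
theorem h137_of_genericY (U₀ : GaugeField (F.P K) 0 (Matrix.specialUnitaryGroup (Fin 2) ℂ)) {c137 sb : ℝ}
    (h137 : ∀ (Y : PBond (F.P n) 0 → Matrix (Fin 2) (Fin 2) ℂ) (b : PBond (F.P K) 0),
      ‖(toL2 F K c₀).symm (LinearMap.adjoint (Qk F n K h c₀ cB U₀) (KinvT F n K h c₀ cB a (DeltaPiSlot F n K h c₀ cB a) U₀ (toL2B F n cB Y))
          - LinearMap.adjoint (Qk F n K h c₀ cB U₀) (((a : ℂ)) • toL2B F n cB Y)) b‖ ≤ c137 * ‖Y‖)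
    (b : WL2 ℂ (fun _ : PBond (F.P n) 0 => cB) W₂) (hb : ∀ c : PBond (F.P n) 0, ‖(toL2B F n cB).symm b c‖ ≤ sb) (bd : PBond (F.P K) 0) :
    ‖(toL2 F K c₀).symm (LinearMap.adjoint (Qk F n K h c₀ cB U₀) (KinvT F n K h c₀ cB a (DeltaPiSlot F n K h c₀ cB a) U₀ b)
        - LinearMap.adjoint (Qk F n K h c₀ cB U₀) (((a : ℂ)) • b)) bd‖ ≤ c137 * sb := by
  have hsb0 : 0 ≤ sb := (norm_nonneg _).trans (hb ⟨default, ⟨0, (F.P n).hd⟩⟩)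
  have h1 := h137 ((toL2B F n cB).symm b) bd
  rw [LinearEquiv.apply_symm_apply] at h1
  exact h1.trans (mul_le_mul_of_nonneg_left ((pi_norm_le_iff_of_nonneg hsb0).mpr hb) (k_nonneg_of_op137 (h := h) U₀ h137))

set_option maxHeartbeats 400000 in
-- HEARTBEAT rule (README): the statement carries the member's full letter terms (`LinearMap.adjoint (Qk …)`, `KinvT`, `GT`, `frakGT`, `HT`, `GprimeT`); the parent ✓p660172 measured > 200k.
/-- ★★★ **BOTH SECOND-ORDER MEMBERS OF (19) FOR THE SOLUTION OF (111), FROM FOUR BACKGROUND-LEVEL ROWS AND THREE SIZES** — ✓`secondOrder_of_eq111_rows` (`toL2 Yf = −𝔊x + Hb` at the slot of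
record) with its `(1 − P₀*) + multiplier` row GENERIC in `x` (`hOpC`, the EX namer's (G17′) text: `≤ cC·‖toL2⁻¹x‖`), its (137) row GENERIC in `Y` (`h137`, ✓`hΔH_of_rows'` VERBATIM, read at
`Y := toL2B⁻¹ b`), and its (139)- and (3.49)-rows SUPPLIED by `hOp139`∕`hOp349` (§3); the field enters only through the sizes `hYsup` (`‖Yf‖ ≤ nY`), `hx` (`‖toL2⁻¹x‖ ≤ sx`), `hb` (`‖toL2B⁻¹b‖ ≤ sb`):
`‖D¹*D¹Yf‖ ≤ (sx + cC·sx + c₁₃₇·sb + k₁₃₉·nY + 28ε₀·nY)·η²`, `‖Δ¹Yf‖ ≤ (… + k₃₄₉·nY + 4ε₀·nY)·η²`.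
[cite: Balaban1985Variational, (111) p.294, (133)–(137) p.298, (139)–(140) p.299, (19) p.281; Balaban1985BackgroundPropagators, (3.10) p.392, (3.49) p.399, (3.126) p.420] -/
theorem secondOrder_of_eq111_opRows {ε₀ : ℝ} {U₀ : GaugeField (F.P K) 0 (Matrix.specialUnitaryGroup (Fin 2) ℂ)} (hU₀ : RegPr F n K ε₀ U₀)
    (hp : PosOnto F n K h c₀ cB a (DeltaPiSlot F n K h c₀ cB a) U₀) (hq : PosPrime F n K h c₀ cB a U₀)
    (x : BondL2K ℂ 3 (periodsT3 F K) c₀ W₂) (b : WL2 ℂ (fun _ : PBond (F.P n) 0 => cB) W₂) (Yf : PBond (F.P K) 0 → Matrix (Fin 2) (Fin 2) ℂ)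
    (hY : toL2 F K c₀ Yf = -(frakGT F n K h c₀ cB a (DeltaPiSlot F n K h c₀ cB a) U₀ x) + HT F n K h c₀ cB a (DeltaPiSlot F n K h c₀ cB a) U₀ b)
    {nY sx sb cC c137 k139 k349 : ℝ} (hYsup : ∀ bd, ‖Yf bd‖ ≤ nY)
    (hx : ∀ bd, ‖(toL2 F K c₀).symm x bd‖ ≤ sx) (hb : ∀ c : PBond (F.P n) 0, ‖(toL2B F n cB).symm b c‖ ≤ sb)
    (hOpC : ∀ (x : BondL2K ℂ 3 (periodsT3 F K) c₀ W₂) (bd : PBond (F.P K) 0),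
      ‖(toL2 F K c₀).symm (LinearMap.adjoint (Qk F n K h c₀ cB U₀) (KinvT F n K h c₀ cB a (DeltaPiSlot F n K h c₀ cB a) U₀
          (Qk F n K h c₀ cB U₀ (GT F n K h c₀ cB a (DeltaPiSlot F n K h c₀ cB a) U₀ x)))
          + DL2 F n K c₀ U₀ (RS F n K h c₀ cB U₀ (DstarL2 F n K c₀ U₀ (GT F n K h c₀ cB a (DeltaPiSlot F n K h c₀ cB a) U₀ x)))) bd‖
        ≤ cC * ‖(toL2 F K c₀).symm x‖)
    (h137 : ∀ (Y : PBond (F.P n) 0 → Matrix (Fin 2) (Fin 2) ℂ) (b : PBond (F.P K) 0),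
      ‖(toL2 F K c₀).symm (LinearMap.adjoint (Qk F n K h c₀ cB U₀) (KinvT F n K h c₀ cB a (DeltaPiSlot F n K h c₀ cB a) U₀ (toL2B F n cB Y))
          - LinearMap.adjoint (Qk F n K h c₀ cB U₀) (((a : ℂ)) • toL2B F n cB Y)) b‖ ≤ c137 * ‖Y‖)
    (hOp139 : ∀ (X : PBond (F.P K) 0 → Matrix (Fin 2) (Fin 2) ℂ) (s : ℝ), RS F n K h c₀ cB U₀ (DstarL2 F n K c₀ U₀ (toL2 F K c₀ X)) = 0 → (∀ bd, ‖X bd‖ ≤ s) →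
      ∀ bd : PBond (F.P K) 0, ‖(toL2 F K c₀).symm (LinearMap.adjoint
          (DL2 F n K c₀ U₀ ∘ₗ GprimeT F n K h c₀ cB a U₀ ∘ₗ RS F n K h c₀ cB U₀ ∘ₗ DstarL2 F n K c₀ U₀)
          (DeltaEta F n K c₀ U₀ (toL2 F K c₀ X))) bd‖ ≤ k139 * s)
    (hOp349 : ∀ (X : PBond (F.P K) 0 → Matrix (Fin 2) (Fin 2) ℂ) (s : ℝ), (∀ bd, ‖X bd‖ ≤ s) → ∀ bd : PBond (F.P K) 0,
      ‖(toL2 F K c₀).symm (DL2 F n K c₀ U₀ (DstarL2 F n K c₀ U₀ (toL2 F K c₀ X) - RS F n K h c₀ cB U₀ (DstarL2 F n K c₀ U₀ (toL2 F K c₀ X)))) bd‖ ≤ k349 * s) :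
    (∀ (μ : Fin (F.P K).d) (y : Site (F.P K) 0),
      ‖covCodiffCurlT 1 (bgUnits F K U₀) Yf μ y‖ ≤ (sx + cC * sx + c137 * sb + k139 * nY + 28 * ε₀ * nY) * eta F n K ^ 2) ∧
    (∀ (ν : Fin (F.P K).d) (y : Site (F.P K) 0),
      ‖covLapFormT 1 (bgUnits F K U₀) Yf ν y‖ ≤ (sx + cC * sx + c137 * sb + k139 * nY + 28 * ε₀ * nY + k349 * nY + 4 * ε₀ * nY) * eta F n K ^ 2) :=
  secondOrder_of_eq111_rows hU₀ hp hq x b Yf hY hYsup hx (hC_of_opC U₀ hOpC x hx) (h137_of_genericY U₀ h137 b hb)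
    (h139_sol_of_op139 hp hq hOp139 x b Yf hY hYsup) (hDPD_sol_of_op349 hp hq hOp349 x b Yf hY hYsup)

set_option maxHeartbeats 400000 in
-- HEARTBEAT rule (README): as above (full letter terms in the statement).
/-- ★★★ **THE JUNCTION CURRENCY WITH FOUR BACKGROUND-LEVEL ROWS** — ✓`secondOrder_of_eq111_rows_rho` (★w2-19200 g5 (G13): «`≤ MΔ·ρ·η²`», `ρ` = the `RegPr` radius) with the N06 rows in their
GENERIC shapes of record (★w2-19200 g6 (G18): `hOpC`, `h137`, `hOp139`, `hOp349`) and the field entering ONLY through three ρ-small sizes — `nY ≤ B₁∕2·ρ`, `sx ≤ cx·ρ`, `sb ≤ cb·ρ`: both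
second-order members of (19) for `Yf` are `≤ MΔ·ρ·η²` with the EXPLICIT `MΔ := cx + cC·cx + c₁₃₇·cb + k₁₃₉·B₁∕2 + 14B₁ + k₃₄₉·B₁∕2 + 2B₁` (`hs139`, `hsC`, `hs137`, `hk₄` of the parent DERIVED).
[cite: Balaban1985Variational, (136) p.298, p.299 ll.6–21, (19) p.281; Balaban1985BackgroundPropagators, (3.49) p.399, (3.126) p.420] -/
theorem secondOrder_of_eq111_opRows_rho {ρ : ℝ} (hρ : 0 ≤ ρ) (hρ1 : ρ ≤ 1) {U₀ : GaugeField (F.P K) 0 (Matrix.specialUnitaryGroup (Fin 2) ℂ)} (hU₀ : RegPr F n K ρ U₀)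
    (hp : PosOnto F n K h c₀ cB a (DeltaPiSlot F n K h c₀ cB a) U₀) (hq : PosPrime F n K h c₀ cB a U₀)
    (x : BondL2K ℂ 3 (periodsT3 F K) c₀ W₂) (b : WL2 ℂ (fun _ : PBond (F.P n) 0 => cB) W₂) (Yf : PBond (F.P K) 0 → Matrix (Fin 2) (Fin 2) ℂ)
    (hY : toL2 F K c₀ Yf = -(frakGT F n K h c₀ cB a (DeltaPiSlot F n K h c₀ cB a) U₀ x) + HT F n K h c₀ cB a (DeltaPiSlot F n K h c₀ cB a) U₀ b)
    {nY sx sb B₁ cx cb cC c137 k139 k349 : ℝ} (hYsup : ∀ bd, ‖Yf bd‖ ≤ nY) (hnY : nY ≤ B₁ / 2 * ρ)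
    (hx : ∀ bd, ‖(toL2 F K c₀).symm x bd‖ ≤ sx) (hsx : sx ≤ cx * ρ)
    (hb : ∀ c : PBond (F.P n) 0, ‖(toL2B F n cB).symm b c‖ ≤ sb) (hsb : sb ≤ cb * ρ)
    (hOpC : ∀ (x : BondL2K ℂ 3 (periodsT3 F K) c₀ W₂) (bd : PBond (F.P K) 0),
      ‖(toL2 F K c₀).symm (LinearMap.adjoint (Qk F n K h c₀ cB U₀) (KinvT F n K h c₀ cB a (DeltaPiSlot F n K h c₀ cB a) U₀
          (Qk F n K h c₀ cB U₀ (GT F n K h c₀ cB a (DeltaPiSlot F n K h c₀ cB a) U₀ x)))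
          + DL2 F n K c₀ U₀ (RS F n K h c₀ cB U₀ (DstarL2 F n K c₀ U₀ (GT F n K h c₀ cB a (DeltaPiSlot F n K h c₀ cB a) U₀ x)))) bd‖
        ≤ cC * ‖(toL2 F K c₀).symm x‖)
    (h137 : ∀ (Y : PBond (F.P n) 0 → Matrix (Fin 2) (Fin 2) ℂ) (b : PBond (F.P K) 0),
      ‖(toL2 F K c₀).symm (LinearMap.adjoint (Qk F n K h c₀ cB U₀) (KinvT F n K h c₀ cB a (DeltaPiSlot F n K h c₀ cB a) U₀ (toL2B F n cB Y))
          - LinearMap.adjoint (Qk F n K h c₀ cB U₀) (((a : ℂ)) • toL2B F n cB Y)) b‖ ≤ c137 * ‖Y‖)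
    (hOp139 : ∀ (X : PBond (F.P K) 0 → Matrix (Fin 2) (Fin 2) ℂ) (s : ℝ), RS F n K h c₀ cB U₀ (DstarL2 F n K c₀ U₀ (toL2 F K c₀ X)) = 0 → (∀ bd, ‖X bd‖ ≤ s) →
      ∀ bd : PBond (F.P K) 0, ‖(toL2 F K c₀).symm (LinearMap.adjoint
          (DL2 F n K c₀ U₀ ∘ₗ GprimeT F n K h c₀ cB a U₀ ∘ₗ RS F n K h c₀ cB U₀ ∘ₗ DstarL2 F n K c₀ U₀)
          (DeltaEta F n K c₀ U₀ (toL2 F K c₀ X))) bd‖ ≤ k139 * s)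
    (hOp349 : ∀ (X : PBond (F.P K) 0 → Matrix (Fin 2) (Fin 2) ℂ) (s : ℝ), (∀ bd, ‖X bd‖ ≤ s) → ∀ bd : PBond (F.P K) 0,
      ‖(toL2 F K c₀).symm (DL2 F n K c₀ U₀ (DstarL2 F n K c₀ U₀ (toL2 F K c₀ X) - RS F n K h c₀ cB U₀ (DstarL2 F n K c₀ U₀ (toL2 F K c₀ X)))) bd‖ ≤ k349 * s) :
    (∀ (μ : Fin (F.P K).d) (y : Site (F.P K) 0),
      ‖covCodiffCurlT 1 (bgUnits F K U₀) Yf μ y‖ ≤ (cx + cC * cx + c137 * cb + k139 * B₁ / 2 + 14 * B₁ + k349 * B₁ / 2 + 2 * B₁) * ρ * eta F n K ^ 2) ∧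
    (∀ (ν : Fin (F.P K).d) (y : Site (F.P K) 0),
      ‖covLapFormT 1 (bgUnits F K U₀) Yf ν y‖ ≤ (cx + cC * cx + c137 * cb + k139 * B₁ / 2 + 14 * B₁ + k349 * B₁ / 2 + 2 * B₁) * ρ * eta F n K ^ 2) := by
  have hkC : 0 ≤ cC := k_nonneg_of_opC (n := n) (h := h) (cB := cB) (a := a) U₀ hOpC
  have hk137 : 0 ≤ c137 := k_nonneg_of_op137 (h := h) U₀ h137
  have hk139 : 0 ≤ k139 := k_nonneg_of_op139 (h := h) (cB := cB) (a := a) U₀ hOp139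
  have hk349 : 0 ≤ k349 := k_nonneg_of_op349 (n := n) (h := h) (cB := cB) U₀ hOp349
  -- the ρ-smallness of the three derived sizes
  have hsC : cC * sx ≤ cC * cx * ρ := (mul_le_mul_of_nonneg_left hsx hkC).trans_eq (by ring)
  have hs137 : c137 * sb ≤ c137 * cb * ρ := (mul_le_mul_of_nonneg_left hsb hk137).trans_eq (by ring)
  have hs139 : k139 * nY ≤ k139 * B₁ / 2 * ρ := (mul_le_mul_of_nonneg_left hnY hk139).trans_eq (by ring)
  exact secondOrder_of_eq111_rows_rho hρ hρ1 hU₀ hp hq x b Yf hY hk349 hYsup hnY hx hsx (hC_of_opC U₀ hOpC x hx) hsC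
    (h137_of_genericY U₀ h137 b hb) hs137 (h139_sol_of_op139 hp hq hOp139 x b Yf hY hYsup) hs139 (hDPD_sol_of_op349 hp hq hOp349 x b Yf hY hYsup)

end Summit.QuantumFields.YangMills.Theorems.Prop7SectET3LandauOpRows

end
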